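import Mathlib
import Summits.Ventures.PercRepro2.Defs
import Summits.Ventures.PercRepro2.Independence
import Summits.Ventures.PercRepro2.Harris
import Summits.Ventures.PercRepro2.CoinDefs
import Summits.Ventures.PercRepro2.CoinInduced
import Summits.Ventures.PercRepro2.CoinVdBK

/-!
# The gate functional is AFFINE in the probability of a coin unseen by the forward cluster
(blind cell PercRepro2, night-2 g6; proofs/NIGHT2-DARC.md §29)

If the avoidance event `R_T` and the two markers `1[a ∈ S⁺]`, `1[b ∈ S⁺]` do not depend on the coin
`e`, the cleared gate functional `phiC` of ANY event is an affine function of `p e`: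
`Φ_p(D) = p e · Φ_{p[e↦1]}(D) + (1 − p e) · Φ_{p[e↦0]}(D)` (`phiC_eq_pin_of_dependsOn`) — the centring
means are the same in the three systems and the `D`-masses obey the pinning identity
`expect_eq_pin`.  Hence row 2′DARC at `p` follows from the row at `p[e↦1]` and at `p[e↦0]`
(`darc_of_pin_of_dependsOn`).  The structural source of such coins: every arc of `e` leaves a
vertex `w ≠ s` that no arc enters (`dependsOn_avoidEvent_of_unentered`,
`dependsOn_marker_of_unentered`).  Used by `CoinPreHead.lean` (a random pre-head arm reduces to
the sure arm) and `CoinDiamond.lean`.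
-/

namespace Summit.Ventures.PercRepro2.Coin

open Classical

/-! ### Expectations that do not see a coin -/

section Unseen

variable {E : Type*} [Fintype E] [DecidableEq E] {R : Type*} [CommRing R]

omit [Fintype E] [CommRing R] in
/-- A function that does not depend on the coin `e` is unchanged by forcing `e` open. -/
lemma apply_update_true_of_dependsOn {f : Config E → R} {e : E}
    (hf : DependsOn f ({e}ᶜ : Set E)) (ω : Config E) : f (Function.update ω e true) = f ω := by
  apply hf
  intro e' he'
  have : e' ≠ e := by simpa using he'
  rw [Function.update_of_ne this]

omit [Fintype E] [CommRing R] in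
/-- A function that does not depend on the coin `e` is unchanged by forcing `e` closed. -/
lemma apply_update_false_of_dependsOn {f : Config E → R} {e : E}
    (hf : DependsOn f ({e}ᶜ : Set E)) (ω : Config E) : f (Function.update ω e false) = f ω := by
  apply hf
  intro e' he'
  have : e' ≠ e := by simpa using he'
  rw [Function.update_of_ne this]

/-- Pinning `e` open does not change the expectation of a function that does not see `e`. -/
lemma expect_update_one_of_dependsOn (p : E → R) {f : Config E → R} {e : E}
    (hf : DependsOn f ({e}ᶜ : Set E)) :
    expect (Function.update p e 1) f = expect p f := by
  rw [expect_update_one]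
  unfold expect
  refine Finset.sum_congr rfl fun ω _ => ?_
  dsimp only
  rw [apply_update_true_of_dependsOn hf]

/-- Pinning `e` closed does not change the expectation of a function that does not see `e`. -/
lemma expect_update_zero_of_dependsOn (p : E → R) {f : Config E → R} {e : E}
    (hf : DependsOn f ({e}ᶜ : Set E)) :
    expect (Function.update p e 0) f = expect p f := by
  rw [expect_update_zero]
  unfold expect
  refine Finset.sum_congr rfl fun ω _ => ?_
  dsimp only
  rw [apply_update_false_of_dependsOn hf]

omit [Fintype E] [DecidableEq E] in
/-- The indicator of an event determined away from `e`, times a function determined away from `e`,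
is determined away from `e`. -/
lemma dependsOn_indicator_mul {A : Set (Config E)} {f : Config E → R} {e : E}
    (hA : DependsOn (· ∈ A) ({e}ᶜ : Set E)) (hf : DependsOn f ({e}ᶜ : Set E)) :
    DependsOn (A.indicator f) ({e}ᶜ : Set E) := by
  intro ω ω' h
  have hmem : ω ∈ A ↔ ω' ∈ A := (hA h).to_iff
  have hfe : f ω = f ω' := hf h
  by_cases hω : ω ∈ A
  · rw [Set.indicator_of_mem hω, Set.indicator_of_mem (hmem.mp hω), hfe]
  · rw [Set.indicator_of_notMem hω, Set.indicator_of_notMem (fun h' => hω (hmem.mpr h'))]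

omit [Fintype E] [DecidableEq E] in
/-- Product of two functions determined away from `e`. -/
lemma dependsOn_mul {f g : Config E → R} {e : E} (hf : DependsOn f ({e}ᶜ : Set E))
    (hg : DependsOn g ({e}ᶜ : Set E)) : DependsOn (fun ω => f ω * g ω) ({e}ᶜ : Set E) :=
  fun _ _ h => by simp only [hf h, hg h]

omit [Fintype E] [DecidableEq E] in
/-- The constant function `1` is determined away from `e`. -/
lemma dependsOn_one {e : E} : DependsOn (fun _ : Config E => (1 : R)) ({e}ᶜ : Set E) :=
  fun _ _ _ => rfl

end Unseen

/-! ### The gate functional is affine in an unseen coin -/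

section Pin

variable {V : Type*} {E : Type*} [Fintype E] [DecidableEq E] {R : Type*} [CommRing R]

/-- Pinning identity for restricted expectations. -/
lemma massE_eq_pin (p : E → R) (f : Config E → R) (D : Set (Config E)) (e : E) :
    massE p f D = p e * massE (Function.update p e 1) f D
      + (1 - p e) * massE (Function.update p e 0) f D := by
  unfold massE
  exact expect_eq_pin p _ e

/-- **The gate functional is affine in the probability of a coin that `R_T` and the markers do not
see**: `Φ_p(D) = p e · Φ_{p[e↦1]}(D) + (1 − p e) · Φ_{p[e↦0]}(D)` for every event `D`. -/
theorem phiC_eq_pin_of_dependsOn (p : E → R) (arcs : E → Finset (V × V)) (s : V) (T : Finset V)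
    (a b : V) (D : Set (Config E)) (e : E)
    (hR : DependsOn (· ∈ avoidEvent arcs s T) ({e}ᶜ : Set E))
    (hX : DependsOn (marker (R := R) arcs s a) ({e}ᶜ : Set E))
    (hY : DependsOn (marker (R := R) arcs s b) ({e}ᶜ : Set E)) :
    phiC p arcs s T a b D =
      p e * phiC (Function.update p e 1) arcs s T a b D
        + (1 - p e) * phiC (Function.update p e 0) arcs s T a b D := by
  -- the three `R_T`-quantities do not see `e`
  have hP1 : prob (Function.update p e 1) (avoidEvent arcs s T) = prob p (avoidEvent arcs s T) := by
    simp only [prob_eq_expect_indicator]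
    exact expect_update_one_of_dependsOn p (dependsOn_indicator_mul hR dependsOn_one)
  have hP0 : prob (Function.update p e 0) (avoidEvent arcs s T) = prob p (avoidEvent arcs s T) := by
    simp only [prob_eq_expect_indicator]
    exact expect_update_zero_of_dependsOn p (dependsOn_indicator_mul hR dependsOn_one)
  have hA1 : massE (Function.update p e 1) (marker (R := R) arcs s a) (avoidEvent arcs s T) =
      massE p (marker (R := R) arcs s a) (avoidEvent arcs s T) :=
    expect_update_one_of_dependsOn p (dependsOn_indicator_mul hR hX)
  have hA0 : massE (Function.update p e 0) (marker (R := R) arcs s a) (avoidEvent arcs s T) =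
      massE p (marker (R := R) arcs s a) (avoidEvent arcs s T) :=
    expect_update_zero_of_dependsOn p (dependsOn_indicator_mul hR hX)
  have hB1 : massE (Function.update p e 1) (marker (R := R) arcs s b) (avoidEvent arcs s T) =
      massE p (marker (R := R) arcs s b) (avoidEvent arcs s T) :=
    expect_update_one_of_dependsOn p (dependsOn_indicator_mul hR hY)
  have hB0 : massE (Function.update p e 0) (marker (R := R) arcs s b) (avoidEvent arcs s T) =
      massE p (marker (R := R) arcs s b) (avoidEvent arcs s T) :=
    expect_update_zero_of_dependsOn p (dependsOn_indicator_mul hR hY)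
  -- the `D`-masses obey the pinning identity
  have hXY := massE_eq_pin p (fun ω => marker (R := R) arcs s a ω * marker (R := R) arcs s b ω) D e
  have hXD := massE_eq_pin p (marker (R := R) arcs s a) D e
  have hYD := massE_eq_pin p (marker (R := R) arcs s b) D e
  have hPD := prob_eq_pin p D e
  simp only [phiC]
  rw [hP1, hP0, hA1, hA0, hB1, hB0, hXY, hXD, hYD, hPD]
  ring

/-- **Row 2′DARC interpolates**: if the row holds with the unseen coin `e` pinned open and pinned
closed, it holds for every probability `p e ∈ [0, 1]` of that coin. -/
theorem darc_of_pin_of_dependsOn [LinearOrder R] [IsStrictOrderedRing R] (p : E → R)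
    (arcs : E → Finset (V × V)) (s : V) (T : Finset V) (a b u w : V) (e : E)
    (h0 : 0 ≤ p e) (h1 : p e ≤ 1)
    (hR : DependsOn (· ∈ avoidEvent arcs s T) ({e}ᶜ : Set E))
    (hX : DependsOn (marker (R := R) arcs s a) ({e}ᶜ : Set E))
    (hY : DependsOn (marker (R := R) arcs s b) ({e}ᶜ : Set E))
    (hopen : DARC (Function.update p e 1) arcs s T a b u w)
    (hclosed : DARC (Function.update p e 0) arcs s T a b u w) :
    DARC p arcs s T a b u w := by
  unfold DARC at *
  rw [phiC_eq_pin_of_dependsOn p arcs s T a b _ e hR hX hY]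
  have h1' : 0 ≤ 1 - p e := by linarith
  exact add_nonneg (mul_nonneg h0 hopen) (mul_nonneg h1' hclosed)

end Pin

/-! ### A coin whose arcs leave an unentered vertex is never seen by the forward cluster -/

section Unentered

variable {V : Type*} {E : Type*}

/-- Nothing but `w` itself reaches a vertex `w` with no in-arc. -/
lemma ne_of_reach_of_noIn {arcs : E → Finset (V × V)} {w : V}
    (hin : ∀ e, ∀ xy ∈ arcs e, xy.2 ≠ w) {s : V} (hs : s ≠ w) {ω : Config E} {y : V}
    (h : Reach arcs ω s y) : y ≠ w := by
  induction h with
  | refl => exact hs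
  | tail _ hstep _ =>
    obtain ⟨e, _, hxy⟩ := hstep
    exact hin e _ hxy

/-- Reachability from `s` is unchanged by the state of a coin all of whose arcs leave an unentered
vertex `w ≠ s`. -/
lemma reach_of_reach_of_unentered {arcs : E → Finset (V × V)} {w : V}
    (hin : ∀ e, ∀ xy ∈ arcs e, xy.2 ≠ w) {e : E} (he : ∀ xy ∈ arcs e, xy.1 = w) {s : V}
    (hs : s ≠ w) {ω ω' : Config E} (hωω' : ∀ e' ∈ ({e}ᶜ : Set E), ω e' = ω' e') {y : V}
    (h : Reach arcs ω s y) : Reach arcs ω' s y := by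
  induction h with
  | refl => exact reach_refl _ _ _
  | tail hxy hstep ih =>
    obtain ⟨e', he', hmem⟩ := hstep
    refine reach_trans ih (reach_of_openArc ⟨e', ?_, hmem⟩)
    by_cases hee : e' = e
    · subst hee
      exact absurd (he _ hmem) (ne_of_reach_of_noIn hin hs hxy)
    · rw [← hωω' e' (by simpa using hee)]
      exact he'

/-- The avoidance event `R_T` does not see such a coin. -/
lemma dependsOn_avoidEvent_of_unentered {arcs : E → Finset (V × V)} {w : V}
    (hin : ∀ e, ∀ xy ∈ arcs e, xy.2 ≠ w) {e : E} (he : ∀ xy ∈ arcs e, xy.1 = w) {s : V}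
    (hs : s ≠ w) (T : Finset V) :
    DependsOn (· ∈ avoidEvent arcs s T) ({e}ᶜ : Set E) := by
  intro ω ω' hωω'
  simp only [avoidEvent, Set.mem_setOf_eq]
  apply propext
  constructor
  · intro h t ht hr
    exact h t ht (reach_of_reach_of_unentered hin he hs (fun e' he' => (hωω' e' he').symm) hr)
  · intro h t ht hr
    exact h t ht (reach_of_reach_of_unentered hin he hs hωω' hr)

/-- A marker `1[a ∈ S⁺]` does not see such a coin. -/
lemma dependsOn_marker_of_unentered {R : Type*} [CommRing R] {arcs : E → Finset (V × V)} {w : V}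
    (hin : ∀ e, ∀ xy ∈ arcs e, xy.2 ≠ w) {e : E} (he : ∀ xy ∈ arcs e, xy.1 = w) {s : V}
    (hs : s ≠ w) (a : V) :
    DependsOn (marker (R := R) arcs s a) ({e}ᶜ : Set E) := by
  intro ω ω' hωω'
  simp only [marker]
  have hiff : Reach arcs ω s a ↔ Reach arcs ω' s a :=
    ⟨reach_of_reach_of_unentered hin he hs hωω',
      reach_of_reach_of_unentered hin he hs (fun e' he' => (hωω' e' he').symm)⟩
  simp only [hiff]

end Unentered

end Summit.Ventures.PercRepro2.Coin
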